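import Summits.QuantumFields.YangMills.Theorems.UnitScaleTiltProp7CoverStencilNaturality
import Summits.QuantumFields.YangMills.Theorems.UnitScaleTiltProp7LaplaceAFlatLetters
import Summits.QuantumFields.YangMills.Theorems.UnitScaleTiltProp7SectET3DeltaEtaExplicitT3
import HarnessLib

/-!
# Route `UnitScaleTilt`, crux K1 «MinimiserStabilityRegPr» (stmt-QuantumFields-19200), route-R E′ (N06) LANE II (★★OWNER RULING №23), brick (C5-a) «LIFT TO A COVER»
# (★p1 g19 NAMER WORD №1∕№3 «(C5-a) := px12 g7 — GO»), FILE F2b of px12 g7's LOCATE `LOCATE-C5a-COVERLIFT-px12g7.md` §2: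
# **THE MEMBER'S HILBERT LETTERS UNDER THE `L^{jc}`-FOLD COVER — DEGREE IDENTITIES AND NATURALITY OF `D`, `D*`, `Δ^η_W = D*D`, `Δ^η(W)`**:
# `‖X̃∘π‖² = (L^{jc})³‖X̃‖²`, `⟪Ã∘π, B̃∘π⟫ = (L^{jc})³⟪Ã, B̃⟫` (bonds and sites), `D_{W∘π}(λ∘π) = (D_Wλ)∘π`, `D*_{W∘π}(X∘π) = (D*_WX)∘π`, `Δ_{W∘π}(λ∘π) = (Δ_Wλ)∘π`,
# `Δ^η(W∘π)(X∘π) = (Δ^η(W)X)∘π`, hence `‖D*_{W∘π}(X∘π)‖² = (L^{jc})³‖D*_WX‖²` and `re⟪X∘π, Δ^η(W∘π)(X∘π)⟫ = (L^{jc})³·re⟪X, Δ^η(W)X⟫`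

Cell `ym3-torus` (HUMAN RULING D-0037, YM ladder rung R3 — YM₃ on T³ is a rung, NOT d = 4, NOT infinite volume, NOT a mass gap, NOT Clay; YM gap NOT proved), width seat
`ym3-torus-px12` (gen 7).  THEOREMS ONLY (0 `def`, 0 `sorry`); `--supports stmt-QuantumFields-19200 --as helper`; count-neutral.  Bookkeeping over ✓`CoverSites` (fibres `(L^{jc})^d`),
✓`Prop7LandauDictT3` (`DL2`∕`DstarL2` read as `covDerivFwdT`∕`covDivFormT`), ✓`Prop7SectET3DeltaEtaExplicit.symm_DeltaEta_toL2_apply` (`Δ^η = η⁻²(D¹*D¹ + Δ′₁)`) and FILE F2a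
✓`Prop7CoverStencilNaturality`; nothing of (V3)∕`hN06`∕the crux is claimed.

WHY.  (C5-a) transfers ✓`Prop7HcoOfDivRecovery.hCo_of_divRecovery`'s row `hRec` from the cover member `F.cover jc` (✓`CoverSites.T3Family.cover`) to `F`: every displayed quantity of the
row at `(F.cover jc, W ∘ projBond, toL2 (X ∘ projBond))` is `(L^{jc})³` times the quantity at `(F, W, toL2 X)`.  This file supplies that for `‖y‖²`, `‖DstarL2 W y‖²` and
`re⟪y, DeltaEtaSlot W y⟫`; the comb letters `QprimeCombL2`∕`RcombL2` (F3) and `Qkc` (F4) follow.  The pullback is written INLINE as `· ∘ projBond (F.P K) jc 0` ∕ `· ∘ proj (F.P K) jc 0` on the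
route carriers (no definition), exactly as ✓`…HalvingSmallMembersCoverLift` does for gauge fields.

References: T. Bałaban, CMP 99 (1985) 389–434 [Balaban1985BackgroundPropagators] ((3.3), (3.8), (3.10)–(3.12), (3.23) pp.390–394); CMP 96 (1984) 223–250 [Balaban1984PropagatorsII]
((2.15)–(2.19) pp.225–226); CMP 109 (1987) 249–301 [Balaban1987RG1] ((0.1)–(0.2) pp.251–252).
-/

noncomputable section

open scoped InnerProductSpace Matrix.Norms.L2Operator BigOperators

namespace Summit.QuantumFields.YangMills.Theorems.Prop7CoverHilbertPullback

open Literature.MathematicalPhysics.QuantumFieldTheory.Balaban1983to89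
open Literature.MathematicalPhysics.QuantumFieldTheory.Balaban1983to89.T3ContinuumYM3Torus
open T3SectALandauChart (eta formComp covDerivFwdT covDivFormT covCodiffCurlT bgUnits)
open B9Eq310Hermitian (deltaPrimeOp)
open B9TorusCalculus (torusT)
open B10Eq27TorusAxialLog (unitsField toUField)
open CoverSites
open Summit.QuantumFields.YangMills.Theorems.Prop7SectET3HilbertLetters (W₂ toL2 toL2S DL2 DstarL2 covLapSite inner_toL2)
open Summit.QuantumFields.YangMills.Theorems.Prop7SectET3WilsonHessian (DeltaEta DeltaEtaSlot)
open Summit.QuantumFields.YangMills.Theorems.Prop7SectET3DeltaEtaExplicit (symm_DeltaEta_toL2_apply)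
open Summit.QuantumFields.YangMills.Theorems.Prop7LandauDict (DL2_toL2S_eq_covDerivFwdT DstarL2_toL2_eq_covDivFormT)
open Summit.QuantumFields.YangMills.Theorems.Prop7LaplaceAFlatLetters (norm_sq_toL2 norm_sq_toL2S)
open Summit.QuantumFields.YangMills.Theorems.Prop7SectET3RealCoordSums (inner_toL2S)
open Summit.QuantumFields.YangMills.Theorems.Prop7CoverStencilNaturality (covDerivFwdT_comp_proj covDivFormT_comp_proj covCodiffCurlT_comp_proj deltaPrimeOp_torusT_comp_proj
  formComp_comp_projBond)

variable (F : T3Family) (jc n K : ℕ) (c₀ : ℝ)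

/-! ## §1 Fibre sums: the degree `(L^{jc})³` -/

/-- A sum over the cover's bonds of a lifted function is `(L^{jc})³` times the sum downstairs. [cite: Balaban1987RG1, (0.2) p.252] -/
theorem sum_bond_comp_projBond {M : Type*} [AddCommMonoid M] (g : PBond (F.P K) 0 → M) :
    ∑ bt : PBond (cover (F.P K) jc) 0, g (projBond (F.P K) jc 0 bt) = ((F.L ^ jc) ^ 3) • ∑ b : PBond (F.P K) 0, g b := by
  classical
  rw [sum_cover_eq_sum_fibre (F.P K) jc 0 (fun bt => g (projBond (F.P K) jc 0 bt)), Finset.smul_sum]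
  refine Finset.sum_congr rfl fun b _ => ?_
  have hconst : ∀ bt ∈ Finset.univ.filter (fun bt : PBond (cover (F.P K) jc) 0 => projBond (F.P K) jc 0 bt = b), g (projBond (F.P K) jc 0 bt) = g b := by
    intro bt hbt
    rw [Finset.mem_filter] at hbt
    rw [hbt.2]
  rw [Finset.sum_congr rfl hconst, Finset.sum_const, card_fibre_bond (F.P K) jc 0 (Nat.zero_le _)]
  rfl

/-- A sum over the cover's sites of a lifted function is `(L^{jc})³` times the sum downstairs. [cite: Balaban1987RG1, (0.2) p.252] -/
theorem sum_site_comp_proj {M : Type*} [AddCommMonoid M] (g : Site (F.P K) 0 → M) :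
    ∑ xt : Site (cover (F.P K) jc) 0, g (proj (F.P K) jc 0 xt) = ((F.L ^ jc) ^ 3) • ∑ x : Site (F.P K) 0, g x := by
  classical
  rw [← Finset.sum_fiberwise_of_maps_to (s := Finset.univ) (t := Finset.univ) (g := proj (F.P K) jc 0) (fun _ _ => Finset.mem_univ _), Finset.smul_sum]
  refine Finset.sum_congr rfl fun x _ => ?_
  have hconst : ∀ xt ∈ Finset.univ.filter (fun xt : Site (cover (F.P K) jc) 0 => proj (F.P K) jc 0 xt = x), g (proj (F.P K) jc 0 xt) = g x := by
    intro xt hxt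
    rw [Finset.mem_filter] at hxt
    rw [hxt.2]
  rw [Finset.sum_congr rfl hconst, Finset.sum_const, card_fibre_site (F.P K) jc 0 (Nat.zero_le _)]
  rfl

/-- The degree as a real number. [cite: Balaban1987RG1, (0.2) p.252] -/
theorem degree_cast : (((F.L ^ jc) ^ 3 : ℕ) : ℝ) = ((F.L : ℝ) ^ jc) ^ 3 := by push_cast; ring

variable [Fact (0 < c₀)]

/-! ## §2 Degree identities for the weighted `L²` norms and pairings -/

/-- ★ **`‖X̃∘π‖² = (L^{jc})³·‖X̃‖²`** (one-forms). [cite: Balaban1985BackgroundPropagators, (3.11) p.392; Balaban1987RG1, (0.2) p.252] -/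
theorem norm_sq_toL2_cover (X : PBond (F.P K) 0 → Matrix (Fin 2) (Fin 2) ℂ) :
    ‖toL2 (F.cover jc) K c₀ (X ∘ projBond (F.P K) jc 0)‖ ^ 2 = ((F.L : ℝ) ^ jc) ^ 3 * ‖toL2 F K c₀ X‖ ^ 2 := by
  rw [norm_sq_toL2, norm_sq_toL2]
  have h : (∑ bt : PBond ((F.cover jc).P K) 0, ∑ i : Fin 2, ∑ i' : Fin 2, ‖(X ∘ projBond (F.P K) jc 0) bt i i'‖ ^ 2)
      = ((F.L ^ jc) ^ 3) • ∑ b : PBond (F.P K) 0, ∑ i : Fin 2, ∑ i' : Fin 2, ‖X b i i'‖ ^ 2 :=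
    sum_bond_comp_projBond F jc K (fun b => ∑ i : Fin 2, ∑ i' : Fin 2, ‖X b i i'‖ ^ 2)
  exact (congrArg (fun t : ℝ => c₀ * t) h).trans (by rw [nsmul_eq_mul, degree_cast]; ring)

/-- ★ **`‖λ∘π‖² = (L^{jc})³·‖λ‖²`** (gauge parameters). [cite: Balaban1985BackgroundPropagators, (3.11) p.392; Balaban1987RG1, (0.2) p.252] -/
theorem norm_sq_toL2S_cover (l : Site (F.P K) 0 → Matrix (Fin 2) (Fin 2) ℂ) :
    ‖toL2S (F.cover jc) K c₀ (l ∘ proj (F.P K) jc 0)‖ ^ 2 = ((F.L : ℝ) ^ jc) ^ 3 * ‖toL2S F K c₀ l‖ ^ 2 := by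
  rw [norm_sq_toL2S, norm_sq_toL2S]
  have h : (∑ xt : Site ((F.cover jc).P K) 0, ∑ i : Fin 2, ∑ i' : Fin 2, ‖(l ∘ proj (F.P K) jc 0) xt i i'‖ ^ 2)
      = ((F.L ^ jc) ^ 3) • ∑ x : Site (F.P K) 0, ∑ i : Fin 2, ∑ i' : Fin 2, ‖l x i i'‖ ^ 2 :=
    sum_site_comp_proj F jc K (fun x => ∑ i : Fin 2, ∑ i' : Fin 2, ‖l x i i'‖ ^ 2)
  exact (congrArg (fun t : ℝ => c₀ * t) h).trans (by rw [nsmul_eq_mul, degree_cast]; ring)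

/-- ★ **`⟪Ã∘π, B̃∘π⟫ = (L^{jc})³·⟪Ã, B̃⟫`** (one-forms). [cite: Balaban1985BackgroundPropagators, (3.11) p.392] -/
theorem inner_toL2_cover (A B : PBond (F.P K) 0 → Matrix (Fin 2) (Fin 2) ℂ) :
    ⟪toL2 (F.cover jc) K c₀ (A ∘ projBond (F.P K) jc 0), toL2 (F.cover jc) K c₀ (B ∘ projBond (F.P K) jc 0)⟫_ℂ
      = ((((F.L ^ jc) ^ 3 : ℕ) : ℂ)) * ⟪toL2 F K c₀ A, toL2 F K c₀ B⟫_ℂ := by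
  rw [inner_toL2, inner_toL2]
  have h : (∑ bt : PBond ((F.cover jc).P K) 0, Matrix.trace (((A ∘ projBond (F.P K) jc 0) bt).conjTranspose * (B ∘ projBond (F.P K) jc 0) bt))
      = ((F.L ^ jc) ^ 3) • ∑ b : PBond (F.P K) 0, Matrix.trace ((A b).conjTranspose * B b) :=
    sum_bond_comp_projBond F jc K (fun b => Matrix.trace ((A b).conjTranspose * B b))
  exact (congrArg (fun t : ℂ => (c₀ : ℂ) * t) h).trans (by rw [nsmul_eq_mul]; ring)

/-- ★ **`⟪λ∘π, μ∘π⟫ = (L^{jc})³·⟪λ, μ⟫`** (gauge parameters). [cite: Balaban1985BackgroundPropagators, p.393] -/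
theorem inner_toL2S_cover (l l' : Site (F.P K) 0 → Matrix (Fin 2) (Fin 2) ℂ) :
    ⟪toL2S (F.cover jc) K c₀ (l ∘ proj (F.P K) jc 0), toL2S (F.cover jc) K c₀ (l' ∘ proj (F.P K) jc 0)⟫_ℂ
      = ((((F.L ^ jc) ^ 3 : ℕ) : ℂ)) * ⟪toL2S F K c₀ l, toL2S F K c₀ l'⟫_ℂ := by
  rw [inner_toL2S, inner_toL2S]
  have h : (∑ xt : Site ((F.cover jc).P K) 0, Matrix.trace (((l ∘ proj (F.P K) jc 0) xt).conjTranspose * (l' ∘ proj (F.P K) jc 0) xt))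
      = ((F.L ^ jc) ^ 3) • ∑ x : Site (F.P K) 0, Matrix.trace ((l x).conjTranspose * l' x) :=
    sum_site_comp_proj F jc K (fun x => Matrix.trace ((l x).conjTranspose * l' x))
  exact (congrArg (fun t : ℂ => (c₀ : ℂ) * t) h).trans (by rw [nsmul_eq_mul]; ring)

/-! ## §3 Naturality of `D`, `D*`, `Δ = D*D` and `Δ^η` under the pullback -/

omit [Fact (0 < c₀)] in
/-- The cover member's spacing is the member's: `η(F.cover jc) = η(F)`. [cite: Balaban1985Variational, (5) p.278] -/
theorem eta_cover : eta (F.cover jc) n K = eta F n K := rfl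

omit [Fact (0 < c₀)] in
/-- The lifted background's unit-valued field is the lift of the unit-valued field. [cite: Balaban1985Averaging, (19) p.21] -/
theorem bgUnits_cover (W : GaugeField (F.P K) 0 (Matrix.specialUnitaryGroup (Fin 2) ℂ)) :
    bgUnits (F.cover jc) K (W ∘ projBond (F.P K) jc 0) = bgUnits F K W ∘ projBond (F.P K) jc 0 := rfl

/-- ★ **`D_{W∘π}(λ∘π) = (D_Wλ)∘π`** ((3.3) is local). [cite: Balaban1985BackgroundPropagators, (3.3) p.390] -/
theorem DL2_cover (W : GaugeField (F.P K) 0 (Matrix.specialUnitaryGroup (Fin 2) ℂ)) (l : Site (F.P K) 0 → Matrix (Fin 2) (Fin 2) ℂ) :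
    (toL2 (F.cover jc) K c₀).symm (DL2 (F.cover jc) n K c₀ (W ∘ projBond (F.P K) jc 0) (toL2S (F.cover jc) K c₀ (l ∘ proj (F.P K) jc 0)))
      = ((toL2 F K c₀).symm (DL2 F n K c₀ W (toL2S F K c₀ l))) ∘ projBond (F.P K) jc 0 := by
  funext bt
  rw [DL2_toL2S_eq_covDerivFwdT, Function.comp_apply, DL2_toL2S_eq_covDerivFwdT, eta_cover, bgUnits_cover]
  exact covDerivFwdT_comp_proj (F.P K) jc (eta F n K) (bgUnits F K W) bt.dir l bt.src

/-- ★ **`D*_{W∘π}(X∘π) = (D*_WX)∘π`** ((3.8) is local). [cite: Balaban1985BackgroundPropagators, (3.8) p.392] -/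
theorem DstarL2_cover (W : GaugeField (F.P K) 0 (Matrix.specialUnitaryGroup (Fin 2) ℂ)) (X : PBond (F.P K) 0 → Matrix (Fin 2) (Fin 2) ℂ) :
    (toL2S (F.cover jc) K c₀).symm (DstarL2 (F.cover jc) n K c₀ (W ∘ projBond (F.P K) jc 0) (toL2 (F.cover jc) K c₀ (X ∘ projBond (F.P K) jc 0)))
      = ((toL2S F K c₀).symm (DstarL2 F n K c₀ W (toL2 F K c₀ X))) ∘ proj (F.P K) jc 0 := by
  funext xt
  rw [DstarL2_toL2_eq_covDivFormT, Function.comp_apply, DstarL2_toL2_eq_covDivFormT, eta_cover, bgUnits_cover]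
  exact covDivFormT_comp_proj (F.P K) jc (eta F n K) (bgUnits F K W) X xt

/-- The same on the `L²` side: `D*_{W∘π}(X̃∘π) = toL2S ((D*_W X̃)♭ ∘ π)`. [cite: Balaban1985BackgroundPropagators, (3.8) p.392] -/
theorem DstarL2_cover' (W : GaugeField (F.P K) 0 (Matrix.specialUnitaryGroup (Fin 2) ℂ)) (X : PBond (F.P K) 0 → Matrix (Fin 2) (Fin 2) ℂ) :
    DstarL2 (F.cover jc) n K c₀ (W ∘ projBond (F.P K) jc 0) (toL2 (F.cover jc) K c₀ (X ∘ projBond (F.P K) jc 0))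
      = toL2S (F.cover jc) K c₀ (((toL2S F K c₀).symm (DstarL2 F n K c₀ W (toL2 F K c₀ X))) ∘ proj (F.P K) jc 0) := by
  exact (LinearEquiv.symm_apply_eq _).mp (DstarL2_cover F jc n K c₀ W X)

/-- The same on the `L²` side for `D`: `D_{W∘π}(λ̃∘π) = toL2 ((D_W λ̃)♭ ∘ π)`. [cite: Balaban1985BackgroundPropagators, (3.3) p.390] -/
theorem DL2_cover' (W : GaugeField (F.P K) 0 (Matrix.specialUnitaryGroup (Fin 2) ℂ)) (l : Site (F.P K) 0 → Matrix (Fin 2) (Fin 2) ℂ) :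
    DL2 (F.cover jc) n K c₀ (W ∘ projBond (F.P K) jc 0) (toL2S (F.cover jc) K c₀ (l ∘ proj (F.P K) jc 0))
      = toL2 (F.cover jc) K c₀ (((toL2 F K c₀).symm (DL2 F n K c₀ W (toL2S F K c₀ l))) ∘ projBond (F.P K) jc 0) := by
  exact (LinearEquiv.symm_apply_eq _).mp (DL2_cover F jc n K c₀ W l)

/-- ★ **`Δ_{W∘π}(λ̃∘π) = toL2S ((Δ_W λ̃)♭ ∘ π)`**, `Δ_W = D*_WD_W` (3.23). [cite: Balaban1985BackgroundPropagators, (3.23) p.394] -/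
theorem covLapSite_cover (W : GaugeField (F.P K) 0 (Matrix.specialUnitaryGroup (Fin 2) ℂ)) (l : Site (F.P K) 0 → Matrix (Fin 2) (Fin 2) ℂ) :
    covLapSite (F.cover jc) n K c₀ (W ∘ projBond (F.P K) jc 0) (toL2S (F.cover jc) K c₀ (l ∘ proj (F.P K) jc 0))
      = toL2S (F.cover jc) K c₀ (((toL2S F K c₀).symm (covLapSite F n K c₀ W (toL2S F K c₀ l))) ∘ proj (F.P K) jc 0) := by
  rw [covLapSite, covLapSite, LinearMap.comp_apply, LinearMap.comp_apply, DL2_cover']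
  set A : PBond (F.P K) 0 → Matrix (Fin 2) (Fin 2) ℂ := (toL2 F K c₀).symm (DL2 F n K c₀ W (toL2S F K c₀ l)) with hA
  rw [DstarL2_cover', hA, LinearEquiv.apply_symm_apply]

/-- ★ **`Δ^η(W∘π)(X̃∘π) = ((Δ^η(W)X̃)♭)∘π`** ((3.10) is local: `η⁻²(D¹*D¹ + Δ′₁)`). [cite: Balaban1985BackgroundPropagators, (3.10)-(3.12) p.392] -/
theorem DeltaEta_cover (W : GaugeField (F.P K) 0 (Matrix.specialUnitaryGroup (Fin 2) ℂ)) (X : PBond (F.P K) 0 → Matrix (Fin 2) (Fin 2) ℂ) :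
    (toL2 (F.cover jc) K c₀).symm (DeltaEta (F.cover jc) n K c₀ (W ∘ projBond (F.P K) jc 0) (toL2 (F.cover jc) K c₀ (X ∘ projBond (F.P K) jc 0)))
      = ((toL2 F K c₀).symm (DeltaEta F n K c₀ W (toL2 F K c₀ X))) ∘ projBond (F.P K) jc 0 := by
  funext bt
  have h1 := symm_DeltaEta_toL2_apply (F := F.cover jc) (n := n) (K := K) (c₀ := c₀) (W ∘ projBond (F.P K) jc 0) (X ∘ projBond (F.P K) jc 0) bt
  have h2 := symm_DeltaEta_toL2_apply (F := F) (n := n) (K := K) (c₀ := c₀) W X (projBond (F.P K) jc 0 bt)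
  have ha : covCodiffCurlT 1 (bgUnits (F.cover jc) K (W ∘ projBond (F.P K) jc 0)) (X ∘ projBond (F.P K) jc 0) bt.dir bt.src
      = covCodiffCurlT 1 (bgUnits F K W) X (projBond (F.P K) jc 0 bt).dir (projBond (F.P K) jc 0 bt).src :=
    covCodiffCurlT_comp_proj (F.P K) jc 1 (bgUnits F K W) X bt.dir bt.src
  have hb : deltaPrimeOp (torusT ((F.cover jc).P K) 0) (fun μ x => bgUnits (F.cover jc) K (W ∘ projBond (F.P K) jc 0) ⟨x, μ⟩) 1
        (formComp (X ∘ projBond (F.P K) jc 0)) bt.dir bt.src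
      = deltaPrimeOp (torusT (F.P K) 0) (fun μ x => bgUnits F K W ⟨x, μ⟩) 1 (formComp X) (projBond (F.P K) jc 0 bt).dir (projBond (F.P K) jc 0 bt).src :=
    deltaPrimeOp_torusT_comp_proj (F.P K) jc (fun μ x => bgUnits F K W ⟨x, μ⟩) 1 (formComp X) bt.dir bt.src
  rw [Function.comp_apply, h1, h2, ha, hb]
  rfl

/-- The same on the `L²` side. [cite: Balaban1985BackgroundPropagators, (3.10)-(3.12) p.392] -/
theorem DeltaEta_cover' (W : GaugeField (F.P K) 0 (Matrix.specialUnitaryGroup (Fin 2) ℂ)) (X : PBond (F.P K) 0 → Matrix (Fin 2) (Fin 2) ℂ) :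
    DeltaEta (F.cover jc) n K c₀ (W ∘ projBond (F.P K) jc 0) (toL2 (F.cover jc) K c₀ (X ∘ projBond (F.P K) jc 0))
      = toL2 (F.cover jc) K c₀ (((toL2 F K c₀).symm (DeltaEta F n K c₀ W (toL2 F K c₀ X))) ∘ projBond (F.P K) jc 0) := by
  exact (LinearEquiv.symm_apply_eq _).mp (DeltaEta_cover F jc n K c₀ W X)

/-! ## §4 The degree identities the transfer reads -/

/-- ★★ **`‖D*_{W∘π}(X̃∘π)‖² = (L^{jc})³·‖D*_W X̃‖²`.** [cite: Balaban1985BackgroundPropagators, (3.8) p.392; Balaban1987RG1, (0.2) p.252] -/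
theorem norm_sq_DstarL2_cover (W : GaugeField (F.P K) 0 (Matrix.specialUnitaryGroup (Fin 2) ℂ)) (X : PBond (F.P K) 0 → Matrix (Fin 2) (Fin 2) ℂ) :
    ‖DstarL2 (F.cover jc) n K c₀ (W ∘ projBond (F.P K) jc 0) (toL2 (F.cover jc) K c₀ (X ∘ projBond (F.P K) jc 0))‖ ^ 2
      = ((F.L : ℝ) ^ jc) ^ 3 * ‖DstarL2 F n K c₀ W (toL2 F K c₀ X)‖ ^ 2 := by
  rw [DstarL2_cover', norm_sq_toL2S_cover, LinearEquiv.apply_symm_apply]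

/-- ★★ **`re⟪X̃∘π, Δ^η(W∘π)(X̃∘π)⟫ = (L^{jc})³·re⟪X̃, Δ^η(W)X̃⟫`** — at the slot of record `DeltaEtaSlot`. [cite: Balaban1985BackgroundPropagators, (3.12) p.392; Balaban1987RG1, (0.2) p.252] -/
theorem re_inner_DeltaEtaSlot_cover (W : GaugeField (F.P K) 0 (Matrix.specialUnitaryGroup (Fin 2) ℂ)) (X : PBond (F.P K) 0 → Matrix (Fin 2) (Fin 2) ℂ) :
    RCLike.re ⟪toL2 (F.cover jc) K c₀ (X ∘ projBond (F.P K) jc 0),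
        DeltaEtaSlot (F.cover jc) n K c₀ (W ∘ projBond (F.P K) jc 0) (toL2 (F.cover jc) K c₀ (X ∘ projBond (F.P K) jc 0))⟫_ℂ
      = ((F.L : ℝ) ^ jc) ^ 3 * RCLike.re ⟪toL2 F K c₀ X, DeltaEtaSlot F n K c₀ W (toL2 F K c₀ X)⟫_ℂ := by
  show RCLike.re ⟪_, DeltaEta (F.cover jc) n K c₀ _ _⟫_ℂ = _ * RCLike.re ⟪_, DeltaEta F n K c₀ W _⟫_ℂ
  rw [DeltaEta_cover', inner_toL2_cover, LinearEquiv.apply_symm_apply, RCLike.re_to_complex, RCLike.re_to_complex, Complex.mul_re]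
  simp only [Complex.natCast_re, Complex.natCast_im, zero_mul, sub_zero]
  push_cast; ring

/-- ★★ **`‖X̃∘π‖²`, `e·‖X̃∘π‖²`: the two scalar slots scale by the degree** (restated for the transfer's `rw` chain). [cite: Balaban1987RG1, (0.2) p.252] -/
theorem mul_norm_sq_toL2_cover (e : ℝ) (X : PBond (F.P K) 0 → Matrix (Fin 2) (Fin 2) ℂ) :
    e * ‖toL2 (F.cover jc) K c₀ (X ∘ projBond (F.P K) jc 0)‖ ^ 2 = ((F.L : ℝ) ^ jc) ^ 3 * (e * ‖toL2 F K c₀ X‖ ^ 2) := by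
  rw [norm_sq_toL2_cover]; ring

end Summit.QuantumFields.YangMills.Theorems.Prop7CoverHilbertPullback

end
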